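import Summits.NavierStokesRegularity.NavierStokesRegularity.Theorems.LerayQuarterDissipationFiniteDissipationLiouvilleTraceDss
import HarnessLib

/-!
# Crux `FiniteDissipationLiouville` (stmt-NavierStokesRegularity-22144): a past-DSS member whose
# trace is LOCALLY BOUNDED AT THE APEX vanishes

Theorems file of route `LerayQuarterDissipation` (lead prover g4; `--supports` the crux, the wall stub
`stub_typeIDSSLiouvilleWall` restricted to the stratum). Navier–Stokes regularity is NOT proved by
anything here; no summit is.

**Main result** (`eq_zero_of_pastDss_of_trace_locallyBounded`). Let `u ∈ 𝒟_{C,K}` be `c`-DSS on the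
past (`c • u(c²t, c•x) = u(t, x)`, `t < 0`, some `c > 1`). If the distributional trace `u(0⁻)`
(lead g3, `exists_tendsto_pairing_finalSlice`) is a BOUNDED FUNCTION NEAR THE APEX — `|L_φ| ≤ M ∫‖φ‖`
for all test fields `φ` supported in some ball `B(0, r₀)` — then `u ≡ 0` on `t < 0`.

With `trace_bounded_off_singularSet` (`…FarField.lean`: the trace of EVERY member of `𝒟` is a bounded
function away from its finitely many singular points) this pins the residue of Bradshaw–Tsai's
OP 5.1 on the stratum to one bit: **a singular past-DSS member of `𝒟` has a trace which is a bounded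
function on `ℝ³ ∖ B(0, δ)` for every `δ > 0` and is NOT a bounded function on any `B(0, r₀)`.**

**Proof.** The trace is `c`-DSS-homogeneous (`trace_pastDss_homogeneous`, lead g3):
`L(φ) = c² L(φ(c ·))`, hence `L(φ) = c^{2k} L(φ(c^k ·))`; the dilates `φ(c^k ·)` concentrate in
`B(0, r₀)` and have `∫‖φ(c^k ·)‖ = c^{−3k} ∫‖φ‖`, so `|L(φ)| ≤ M c^{−k} ∫‖φ‖ → 0`: the trace vanishes,
and the final-slice leaf (`eq_zero_of_tendsto_finalSlice`, Lemarié-Rieusset Thm. 15.4) gives `u ≡ 0`.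
-/

noncomputable section

-- the summit and its single sub-problem share the name (CONVENTIONS §1), as in every Theorems file
set_option linter.dupNamespace false

namespace Summit.NavierStokesRegularity.NavierStokesRegularity.Theorems.FiniteDissipationLiouville.Birth.Apex

open MeasureTheory Set Filter Topology Metric Function TopologicalSpace
open Literature.Analysis Literature.Analysis.FluidPDE
open scoped ENNReal NNReal RealInnerProductSpace

variable {C K : ℝ} {u : ℝ → EuclideanSpace ℝ (Fin 3) → EuclideanSpace ℝ (Fin 3)}

/-- **Iterated homogeneity of the trace of a past-DSS member**: `L(φ) = c^{2k} L(φ(c^k ·))` for the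
trace values of `φ` and of its dilate `φ(c^k ·)`. -/
theorem trace_pastDss_homogeneous_pow (hu : IsTypeIAncientMild C u)
    (hlaw : ∀ s : ℝ, s < 0 → ∫⁻ x, ‖fderiv ℝ (u s) x‖ₑ ^ 2 ≤ ENNReal.ofReal (K / Real.sqrt (-s)))
    {c : ℝ} (hc : 1 < c) (hdss : ∀ t : ℝ, t < 0 → ∀ x, c • u (c ^ 2 * t) (c • x) = u t x)
    {φ : EuclideanSpace ℝ (Fin 3) → EuclideanSpace ℝ (Fin 3)}
    (hφ : FunctionSpaces.IsTestFunctionOn (⊤ : Opens (EuclideanSpace ℝ (Fin 3))) φ) (k : ℕ)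
    {L Lk : ℝ} (hL : Tendsto (fun t => ∫ x, ⟪u t x, φ x⟫) (𝓝[<] 0) (𝓝 L))
    (hLk : Tendsto (fun t => ∫ x, ⟪u t x, φ ((c ^ k) • x)⟫) (𝓝[<] 0) (𝓝 Lk)) :
    L = c ^ (2 * k) * Lk := by
  have hc0 : 0 < c := by linarith
  induction k generalizing Lk with
  | zero =>
      simp only [pow_zero, one_smul, mul_zero, one_mul] at hLk ⊢
      exact tendsto_nhds_unique hL hLk
  | succ k ih =>
      -- the limit for the `k`-th dilate exists
      obtain ⟨Lk', hLk'⟩ := exists_tendsto_pairing_finalSlice hu hlaw (hφ.comp_smul_top (pow_ne_zero k hc0.ne'))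
      have h1 := ih hLk'
      -- homogeneity between the `k`-th and the `(k+1)`-st dilate
      have hψ : Tendsto (fun t => ∫ y, ⟪u t y, (fun x => φ ((c ^ (k + 1)) • x)) (c⁻¹ • y)⟫)
          (𝓝[<] 0) (𝓝 Lk') := by
        refine hLk'.congr' (Eventually.of_forall fun t => ?_)
        refine integral_congr_ae (ae_of_all _ fun y => ?_)
        simp only [smul_smul, pow_succ, mul_assoc, mul_inv_cancel₀ hc0.ne', mul_one]
      have h2 := trace_pastDss_homogeneous hc hdss hLk hψ
      rw [h1, h2, pow_succ, show 2 * (k + 1) = 2 * k + 2 by ring, pow_add]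
      field_simp

/-- **A past-DSS member of the stratum whose trace is a bounded function near the apex vanishes.**
If `u ∈ 𝒟_{C,K}` is `c`-DSS on the past (`c > 1`) and, for some `r₀ > 0` and `M`, every test field
`φ` supported in `B(0, r₀)` has trace value `|L_φ| ≤ M ∫‖φ‖`, then `u ≡ 0` on `t < 0`. -/
theorem eq_zero_of_pastDss_of_trace_locallyBounded (hu : IsTypeIAncientMild C u)
    (hlaw : ∀ s : ℝ, s < 0 → ∫⁻ x, ‖fderiv ℝ (u s) x‖ₑ ^ 2 ≤ ENNReal.ofReal (K / Real.sqrt (-s)))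
    {c : ℝ} (hc : 1 < c) (hdss : ∀ t : ℝ, t < 0 → ∀ x, c • u (c ^ 2 * t) (c • x) = u t x)
    {r₀ M : ℝ} (hr₀ : 0 < r₀)
    (hbd : ∀ φ : EuclideanSpace ℝ (Fin 3) → EuclideanSpace ℝ (Fin 3),
      FunctionSpaces.IsTestFunctionOn (⊤ : Opens (EuclideanSpace ℝ (Fin 3))) φ →
      (∀ x, φ x ≠ 0 → ‖x‖ < r₀) →
      ∀ L : ℝ, Tendsto (fun t => ∫ x, ⟪u t x, φ x⟫) (𝓝[<] 0) (𝓝 L) → |L| ≤ M * ∫ x, ‖φ x‖) :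
    ∀ t < 0, ∀ x, u t x = 0 := by
  have hc0 : 0 < c := by linarith
  refine eq_zero_of_tendsto_finalSlice hu hlaw fun φ hφ => ?_
  obtain ⟨L, hL⟩ := exists_tendsto_pairing_finalSlice hu hlaw hφ
  suffices hL0 : L = 0 by rwa [hL0] at hL
  -- a support radius of `φ`
  obtain ⟨R, hR0, hR⟩ := hφ.hasCompactSupport.isCompact.isBounded.subset_ball_lt 0
    (0 : EuclideanSpace ℝ (Fin 3))
  have hsuppφ : ∀ x, φ x ≠ 0 → ‖x‖ < R := fun x hx => by
    have h := hR (subset_tsupport _ (Function.mem_support.2 hx))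
    rwa [mem_ball_zero_iff] at h
  -- `M ≥ 0` may be assumed (replace `M` by `max M 0`)
  have hbd' : ∀ k : ℕ, R ≤ c ^ k * r₀ → |L| ≤ max M 0 * (c ^ k)⁻¹ * ∫ x, ‖φ x‖ := by
    intro k hk
    have hck : 0 < c ^ k := pow_pos hc0 k
    obtain ⟨Lk, hLk⟩ := exists_tendsto_pairing_finalSlice hu hlaw (hφ.comp_smul_top hck.ne')
    have hrel := trace_pastDss_homogeneous_pow hu hlaw hc hdss hφ k hL hLk
    -- the dilate is supported in `B(0, r₀)`
    have hsupp : ∀ x, φ ((c ^ k) • x) ≠ 0 → ‖x‖ < r₀ := by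
      intro x hx
      have h := hsuppφ _ hx
      rw [norm_smul, Real.norm_of_nonneg hck.le] at h
      by_contra hnot
      push Not at hnot
      have : c ^ k * r₀ ≤ c ^ k * ‖x‖ := mul_le_mul_of_nonneg_left hnot hck.le
      linarith
    have hLkb := hbd _ (hφ.comp_smul_top hck.ne') hsupp Lk hLk
    -- `∫ ‖φ(c^k x)‖ = (c^k)⁻³ ∫ ‖φ‖`
    have hint : ∫ x, ‖φ ((c ^ k) • x)‖ = ((c ^ k) ^ 3)⁻¹ * ∫ x, ‖φ x‖ := by
      have h := Measure.integral_comp_smul volume (fun x => ‖φ x‖) (c ^ k)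
      rw [finrank_euclideanSpace_fin, abs_of_nonneg (inv_nonneg.2 (pow_nonneg hck.le 3)),
        smul_eq_mul] at h
      exact h
    rw [hint] at hLkb
    have hI0 : 0 ≤ ∫ x, ‖φ x‖ := integral_nonneg fun _ => norm_nonneg _
    calc |L| = c ^ (2 * k) * |Lk| := by
          rw [hrel, abs_mul, abs_of_nonneg (pow_nonneg hc0.le _)]
      _ ≤ c ^ (2 * k) * (M * (((c ^ k) ^ 3)⁻¹ * ∫ x, ‖φ x‖)) :=
          mul_le_mul_of_nonneg_left hLkb (pow_nonneg hc0.le _)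
      _ ≤ c ^ (2 * k) * (max M 0 * (((c ^ k) ^ 3)⁻¹ * ∫ x, ‖φ x‖)) := by
          gcongr
          exact le_max_left _ _
      _ = max M 0 * (c ^ k)⁻¹ * ∫ x, ‖φ x‖ := by
          field_simp
          ring
  -- let `k → ∞`
  have hlim : Tendsto (fun k : ℕ => max M 0 * (c ^ k)⁻¹ * ∫ x, ‖φ x‖) atTop (𝓝 0) := by
    have h1 : Tendsto (fun k : ℕ => (c⁻¹) ^ k) atTop (𝓝 0) :=
      tendsto_pow_atTop_nhds_zero_of_lt_one (inv_nonneg.2 hc0.le) (inv_lt_one_of_one_lt₀ hc)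
    have h2 := (h1.const_mul (max M 0)).mul_const (∫ x, ‖φ x‖)
    simp only [mul_zero, zero_mul] at h2
    refine h2.congr fun k => ?_
    rw [inv_pow]
  have hev : ∀ᶠ k : ℕ in atTop, |L| ≤ max M 0 * (c ^ k)⁻¹ * ∫ x, ‖φ x‖ := by
    have hgrow : Tendsto (fun k : ℕ => c ^ k * r₀) atTop atTop :=
      (tendsto_pow_atTop_atTop_of_one_lt hc).atTop_mul_const hr₀
    filter_upwards [hgrow.eventually_ge_atTop R] with k hk
    exact hbd' k hk
  have h0 : |L| ≤ 0 := ge_of_tendsto hlim hev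
  exact abs_eq_zero.1 (le_antisymm h0 (abs_nonneg L))

/-- **Regularity form**: such a member is not singular at the apex. -/
theorem not_singular_of_pastDss_of_trace_locallyBounded (hu : IsTypeIAncientMild C u)
    (hlaw : ∀ s : ℝ, s < 0 → ∫⁻ x, ‖fderiv ℝ (u s) x‖ₑ ^ 2 ≤ ENNReal.ofReal (K / Real.sqrt (-s)))
    {c : ℝ} (hc : 1 < c) (hdss : ∀ t : ℝ, t < 0 → ∀ x, c • u (c ^ 2 * t) (c • x) = u t x)
    {r₀ M : ℝ} (hr₀ : 0 < r₀)
    (hbd : ∀ φ : EuclideanSpace ℝ (Fin 3) → EuclideanSpace ℝ (Fin 3),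
      FunctionSpaces.IsTestFunctionOn (⊤ : Opens (EuclideanSpace ℝ (Fin 3))) φ →
      (∀ x, φ x ≠ 0 → ‖x‖ < r₀) →
      ∀ L : ℝ, Tendsto (fun t => ∫ x, ⟪u t x, φ x⟫) (𝓝[<] 0) (𝓝 L) → |L| ≤ M * ∫ x, ‖φ x‖) :
    ¬ (∀ r > 0, ∀ M' : ℝ, ∃ t ∈ Set.Ioo (-(r ^ 2)) (0 : ℝ),
        ∃ x ∈ Metric.ball (0 : EuclideanSpace ℝ (Fin 3)) r, M' < ‖u t x‖) := by
  intro hsing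
  obtain ⟨t, ht, x, -, hM⟩ := hsing 1 one_pos 0
  rw [eq_zero_of_pastDss_of_trace_locallyBounded hu hlaw hc hdss hr₀ hbd t ht.2 x, norm_zero] at hM
  exact lt_irrefl _ hM

/-- **Sharp form: a past-DSS member whose trace lies in `L^p` near the apex for some `p > 3`
vanishes.** Phrased with the dual exponent `q = p' ∈ [1, 3/2)`: if `|L_φ| ≤ M (∫‖φ‖^q)^{1/q}` for all
test fields `φ` supported in some `B(0, r₀)`, then `u ≡ 0` on `t < 0` (the dilates `φ(c^k ·)` have
`‖φ(c^k ·)‖_{L^q} = c^{−3k/q}‖φ‖_{L^q}` while `L(φ) = c^{2k} L(φ(c^k ·))`, and `2 − 3/q < 0`). The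
borderline `p = 3` is the landed `L³` leaf (Albritton–Barker); `a ∼ |x|⁻¹ ∈ L^{3,∞} ∖ L³`. -/
theorem eq_zero_of_pastDss_of_trace_lq_dual (hu : IsTypeIAncientMild C u)
    (hlaw : ∀ s : ℝ, s < 0 → ∫⁻ x, ‖fderiv ℝ (u s) x‖ₑ ^ 2 ≤ ENNReal.ofReal (K / Real.sqrt (-s)))
    {c : ℝ} (hc : 1 < c) (hdss : ∀ t : ℝ, t < 0 → ∀ x, c • u (c ^ 2 * t) (c • x) = u t x)
    {r₀ M q : ℝ} (hr₀ : 0 < r₀) (hq0 : 0 < q) (hq : q < 3 / 2)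
    (hbd : ∀ φ : EuclideanSpace ℝ (Fin 3) → EuclideanSpace ℝ (Fin 3),
      FunctionSpaces.IsTestFunctionOn (⊤ : Opens (EuclideanSpace ℝ (Fin 3))) φ →
      (∀ x, φ x ≠ 0 → ‖x‖ < r₀) →
      ∀ L : ℝ, Tendsto (fun t => ∫ x, ⟪u t x, φ x⟫) (𝓝[<] 0) (𝓝 L) →
        |L| ≤ M * (∫ x, ‖φ x‖ ^ q) ^ (1 / q)) :
    ∀ t < 0, ∀ x, u t x = 0 := by
  have hc0 : 0 < c := by linarith
  -- the exponent `e = 2 − 3/q < 0` and the base `b = c^e ∈ (0, 1)`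
  obtain ⟨e, he⟩ : ∃ e : ℝ, e = 2 - 3 / q := ⟨_, rfl⟩
  have he0 : e < 0 := by
    rw [he, sub_neg, lt_div_iff₀ hq0]; linarith
  have hb0 : 0 ≤ c ^ e := Real.rpow_nonneg hc0.le e
  have hb1 : c ^ e < 1 := Real.rpow_lt_one_of_one_lt_of_neg hc he0
  refine eq_zero_of_tendsto_finalSlice hu hlaw fun φ hφ => ?_
  obtain ⟨L, hL⟩ := exists_tendsto_pairing_finalSlice hu hlaw hφ
  suffices hL0 : L = 0 by rwa [hL0] at hL
  obtain ⟨R, hR0, hR⟩ := hφ.hasCompactSupport.isCompact.isBounded.subset_ball_lt 0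
    (0 : EuclideanSpace ℝ (Fin 3))
  have hsuppφ : ∀ x, φ x ≠ 0 → ‖x‖ < R := fun x hx => by
    have h := hR (subset_tsupport _ (Function.mem_support.2 hx))
    rwa [mem_ball_zero_iff] at h
  set I : ℝ := ∫ x, ‖φ x‖ ^ q with hI
  have hI0 : 0 ≤ I := integral_nonneg fun _ => Real.rpow_nonneg (norm_nonneg _) _
  have hbd' : ∀ k : ℕ, R ≤ c ^ k * r₀ → |L| ≤ max M 0 * I ^ (1 / q) * (c ^ e) ^ k := by
    intro k hk
    have hck : 0 < c ^ k := pow_pos hc0 k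
    obtain ⟨Lk, hLk⟩ := exists_tendsto_pairing_finalSlice hu hlaw (hφ.comp_smul_top hck.ne')
    have hrel := trace_pastDss_homogeneous_pow hu hlaw hc hdss hφ k hL hLk
    have hsupp : ∀ x, φ ((c ^ k) • x) ≠ 0 → ‖x‖ < r₀ := by
      intro x hx
      have h := hsuppφ _ hx
      rw [norm_smul, Real.norm_of_nonneg hck.le] at h
      by_contra hnot
      push Not at hnot
      have : c ^ k * r₀ ≤ c ^ k * ‖x‖ := mul_le_mul_of_nonneg_left hnot hck.le
      linarith
    have hLkb := hbd _ (hφ.comp_smul_top hck.ne') hsupp Lk hLk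
    -- `∫ ‖φ(c^k x)‖^q = (c^k)⁻³ I`
    have hint : ∫ x, ‖φ ((c ^ k) • x)‖ ^ q = ((c ^ k) ^ 3)⁻¹ * I := by
      have h := Measure.integral_comp_smul volume (fun x => ‖φ x‖ ^ q) (c ^ k)
      rw [finrank_euclideanSpace_fin, abs_of_nonneg (inv_nonneg.2 (pow_nonneg hck.le 3)),
        smul_eq_mul] at h
      exact h
    rw [hint] at hLkb
    -- `(((c^k)³)⁻¹ I)^{1/q} = (c^k)^{-3/q} I^{1/q}` and `c^{2k} (c^k)^{-3/q} = (c^e)^k`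
    have hpow : (((c ^ k) ^ 3)⁻¹ * I) ^ (1 / q) = (c ^ k) ^ (-(3 / q)) * I ^ (1 / q) := by
      rw [Real.mul_rpow (inv_nonneg.2 (pow_nonneg hck.le 3)) hI0]
      congr 1
      rw [← Real.rpow_natCast (c ^ k) 3, ← Real.rpow_neg_one, ← Real.rpow_mul hck.le,
        ← Real.rpow_mul hck.le]
      norm_num
      rw [div_eq_mul_inv]
    have hscale : c ^ (2 * k) * (c ^ k) ^ (-(3 / q)) = (c ^ e) ^ k := by
      rw [show c ^ (2 * k) = (c ^ k) ^ 2 by ring, ← Real.rpow_natCast ((c ^ k)) 2,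
        ← Real.rpow_add hck, ← Real.rpow_natCast c k, ← Real.rpow_mul hc0.le, he,
        ← Real.rpow_mul_natCast hc0.le]
      congr 1
      push_cast
      ring
    calc |L| = c ^ (2 * k) * |Lk| := by
          rw [hrel, abs_mul, abs_of_nonneg (pow_nonneg hc0.le _)]
      _ ≤ c ^ (2 * k) * (max M 0 * (((c ^ k) ^ 3)⁻¹ * I) ^ (1 / q)) := by
          refine mul_le_mul_of_nonneg_left (hLkb.trans ?_) (pow_nonneg hc0.le _)
          exact mul_le_mul_of_nonneg_right (le_max_left _ _) (Real.rpow_nonneg (by positivity) _)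
      _ = max M 0 * I ^ (1 / q) * (c ^ (2 * k) * (c ^ k) ^ (-(3 / q))) := by rw [hpow]; ring
      _ = max M 0 * I ^ (1 / q) * (c ^ e) ^ k := by rw [hscale]
  have hlim : Tendsto (fun k : ℕ => max M 0 * I ^ (1 / q) * (c ^ e) ^ k) atTop (𝓝 0) := by
    have h1 : Tendsto (fun k : ℕ => (c ^ e) ^ k) atTop (𝓝 0) :=
      tendsto_pow_atTop_nhds_zero_of_lt_one hb0 hb1
    simpa using h1.const_mul (max M 0 * I ^ (1 / q))
  have hev : ∀ᶠ k : ℕ in atTop, |L| ≤ max M 0 * I ^ (1 / q) * (c ^ e) ^ k := by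
    have hgrow : Tendsto (fun k : ℕ => c ^ k * r₀) atTop atTop :=
      (tendsto_pow_atTop_atTop_of_one_lt hc).atTop_mul_const hr₀
    filter_upwards [hgrow.eventually_ge_atTop R] with k hk
    exact hbd' k hk
  have h0 : |L| ≤ 0 := ge_of_tendsto hlim hev
  exact abs_eq_zero.1 (le_antisymm h0 (abs_nonneg L))

end Summit.NavierStokesRegularity.NavierStokesRegularity.Theorems.FiniteDissipationLiouville.Birth.Apex

end
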